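import Summits.FinalStateConjecture.FinalStateConjecture.Theorems.EIHFluxBalanceInertialRecessionRechartWhiteHoleKerrEscape
import Summits.FinalStateConjecture.FinalStateConjecture.Theorems.EIHFluxBalanceInertialRecessionRechartWhiteHoleExclusion

/-!
# Route EIHFluxBalance — `InertialRecession`, re-charting: painted ROTATING white holes are
# excluded (no velocity convergence)

Helper file for the crux `stmt-FinalStateConjecture-10166`
(`Summit.FinalStateConjecture.FinalStateConjecture.Theses.EIHFluxBalance.InertialRecession`),
stub `stub_rechart` of line `sublinear-is-free-clean-window-charges`.

`false_of_antiOrthochronous_hole_spin`: in the lab picture of the crux, a hole of ANY spin painted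
with an anti-orthochronous frame (`(Λᵢ(t)e₀)⁰ < 0` for all `t`) is impossible, granted eventual
lab-time causality of the chart (and (Ofut)), exhaustion (vii), `O = J⁺(Σ) ∩ I⁻(Φ(late painted
exterior))`, a normalised representative `Q` of the painted frame of hole `i` modulo the stabiliser
with vanishing drift over bounded windows, and the slaved centre mismatch — NO convergence of
velocities. Proof as in `…RechartWhiteHoleExclusion` along the escape curve of
`…RechartWhiteHoleKerrEscape`: the first parameter in the closed set `J⁺(Σ)` is either at painted
radius `> r₊` (then slightly earlier points are in the open set `Φ(late painted exterior) ⊆ J⁺(Σ)`,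
against minimality) or `≤ r₊` (then the point is in `O` by push-up, against the horizon lemma F1
`painted_exterior_of_mem_exterior_guaranteed`).

[O'Neill 1983, Ch. 14, Lemma 14.29; folklore]
-/

noncomputable section

set_option linter.dupNamespace false

open scoped Topology Manifold ContDiff BigOperators
open Set Function Filter Metric Topology TopologicalSpace Literature.Geometry.Lorentzian

namespace Summit.FinalStateConjecture.FinalStateConjecture.Theorems

section Exclusion

variable {X : Type} [TopologicalSpace X] [ChartedSpace E3 X] [IsManifold (𝓡 3) ∞ X]
  [ConnectedSpace X] {D : InitialDataSet (𝓡 3) X}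

/-- First-parameter bookkeeping (registered stub `not_mem_of_lt_csInf_rechart` of the crux item):
below the infimum of a set of reals bounded below by `0` there is no member. [folklore] -/
theorem not_mem_of_lt_csInf_rechart : ∀ {A : Set ℝ}, (∀ s ∈ A, (0 : ℝ) ≤ s) → ∀ {s : ℝ}, s < sInf A → s ∉ A :=
  fun h0 _ hs hsA ↦ (not_le.mpr hs) (csInf_le ⟨0, h0⟩ hsA)

-- long statement and bookkeeping proof
set_option maxHeartbeats 800000 in
/-- **Painted rotating white holes are excluded.** See the module docstring. [folklore] -/
theorem false_of_antiOrthochronous_hole_spin (𝒟 : VacuumCauchyDevelopment D) {N : ℕ} (i : Fin N)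
    (M a rin : Fin N → ℝ) (Λ : Fin N → ℝ → lorentzGroup) (ξ : Fin N → ℝ → E3)
    (hM : 0 < M i) (hrin : ∀ j, rin j < Kerr.rPlus (M j) (a j)) {γ : ℝ}
    (hγb : ∀ j t, |((Λ j t : E4 ≃L[ℝ] E4) (E4.basisVector 0)) 0| ≤ γ)
    (hΛc : ∀ j, Continuous fun t ↦ ((Λ j t : E4 ≃L[ℝ] E4) : E4 →L[ℝ] E4))
    (hξc : ∀ j, Continuous (ξ j)) (hξd : Differentiable ℝ (ξ i))
    (Q : ℝ → lorentzGroup)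
    (hQ0 : ∀ t, (Q t : E4 ≃L[ℝ] E4) (E4.basisVector 0) = (Λ i t : E4 ≃L[ℝ] E4) (E4.basisVector 0))
    (hQbil : ∀ t c x, boostedKerrBilin (Λ i t) c (M i) (a i) x = boostedKerrBilin (Q t) c (M i) (a i) x)
    (hQrad : ∀ t c x, Kerr.radius (a i) (poincareInv (Λ i t) c x) =
      Kerr.radius (a i) (poincareInv (Q t) c x))
    (hQdrift : ∀ L δ : ℝ, 0 < L → 0 < δ → ∃ T : ℝ, ∀ t₀ t : ℝ, T ≤ t₀ → |t - t₀| ≤ L →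
      ‖((Q t : E4 ≃L[ℝ] E4) : E4 →L[ℝ] E4) - ((Q t₀ : E4 ≃L[ℝ] E4) : E4 →L[ℝ] E4)‖ ≤ δ)
    (hmis : Tendsto (fun t ↦ deriv (ξ i) t - ((((Λ i t : E4 ≃L[ℝ] E4) (E4.basisVector 0)) 0)⁻¹ •
      E4.spatial ((Λ i t : E4 ≃L[ℝ] E4) (E4.basisVector 0)))) atTop (𝓝 0))
    (hneg : ∀ t, ((Λ i t : E4 ≃L[ℝ] E4) (E4.basisVector 0)) 0 < 0)
    (hsep : ∀ j, j ≠ i → Tendsto (fun t ↦ ‖ξ i t - ξ j t‖) atTop atTop)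
    (U : Opens E4) (Φ : U → 𝒟.carrier) (hΦ : ContMDiff 𝓘(ℝ, E4) (𝓡 4) ∞ Φ) {τ₀ : ℝ}
    (hU : {x : E4 | τ₀ < x 0 ∧ ∀ j, rin j < Kerr.radius (a j) (poincareInv (Λ j (x 0))
      (E4.ofTimeSpace (x 0) (ξ j (x 0))) x)} ⊆ (U : Set E4))
    (hembΦ : IsOpenEmbedding (({x : U | τ₀ < x.1 0} : Set U).restrict Φ))
    {k : ℕ} (hdev : Tendsto (fun t ↦ 𝒟.toSpacetime.deviationCk ⟨U, fun x ↦ Minkowski.bilin +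
      ∑ j, (boostedKerrBilin (Λ j (x 0)) (E4.ofTimeSpace (x 0) (ξ j (x 0))) (M j) (a j) x -
        Minkowski.bilin), fun x ↦ x 0, E4.spatialNorm⟩ Φ k t) atTop (𝓝 0))
    (O : Set 𝒟.carrier)
    (hO : O = 𝒟.metric.causalFuture 𝒟.timeOrientation (range 𝒟.embed) ∩
      𝒟.metric.chronologicalPast 𝒟.timeOrientation (Φ '' {x : U | τ₀ < x.1 0 ∧ ∀ j,
        Kerr.rPlus (M j) (a j) < Kerr.radius (a j) (poincareInv (Λ j (x.1 0))
          (E4.ofTimeSpace (x.1 0) (ξ j (x.1 0))) x.1)}))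
    (himO : Φ '' {x : U | τ₀ < x.1 0 ∧ ∀ j, Kerr.rPlus (M j) (a j) < Kerr.radius (a j)
      (poincareInv (Λ j (x.1 0)) (E4.ofTimeSpace (x.1 0) (ξ j (x.1 0))) x.1)} ⊆ O)
    (hexh : ∀ t₁ : ℝ, τ₀ < t₁ → O \ Φ '' {x : U | t₁ < x.1 0 ∧ ∀ j, Kerr.rPlus (M j) (a j) <
      Kerr.radius (a j) (poincareInv (Λ j (x.1 0)) (E4.ofTimeSpace (x.1 0) (ξ j (x.1 0))) x.1)} ⊆
      𝒟.metric.causalPast 𝒟.timeOrientation (Φ '' {x : U | x.1 0 = t₁ ∧ ∀ j, Kerr.rPlus (M j) (a j) <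
        Kerr.radius (a j) (poincareInv (Λ j (x.1 0)) (E4.ofTimeSpace (x.1 0) (ξ j (x.1 0))) x.1)}))
    {τ₁ : ℝ}
    (hT : ∀ x y : U, (τ₁ < x.1 0 ∧ ∀ j, rin j < Kerr.radius (a j) (poincareInv (Λ j (x.1 0))
      (E4.ofTimeSpace (x.1 0) (ξ j (x.1 0))) x.1)) → (τ₁ < y.1 0 ∧ ∀ j, rin j <
      Kerr.radius (a j) (poincareInv (Λ j (y.1 0)) (E4.ofTimeSpace (y.1 0) (ξ j (y.1 0))) y.1)) →
      Φ y ∈ 𝒟.metric.causalFuture 𝒟.timeOrientation {Φ x} → x.1 0 ≤ y.1 0)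
    {TO : ℝ}
    (hOfut : ∀ x : U, TO < x.1 0 → (∀ j, rin j < Kerr.radius (a j) (poincareInv (Λ j (x.1 0))
      (E4.ofTimeSpace (x.1 0) (ξ j (x.1 0))) x.1)) → ∀ w : E4, 0 < w 0 →
      𝒟.metric.val (Φ x) (mfderiv 𝓘(ℝ, E4) (𝓡 4) Φ x w) (mfderiv 𝓘(ℝ, E4) (𝓡 4) Φ x w) < 0 →
        𝒟.timeOrientation.IsFutureDirected (mfderiv 𝓘(ℝ, E4) (𝓡 4) Φ x w)) : False := by
  obtain ⟨xs, hxsU, hcurve, hpts, hstart, hend⟩ := exists_escape_curve_spin i M a rin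
    (fun j ↦ Kerr.rPlus (M j) (a j)) Λ ξ hM (hrin i) hγb hΛc hξc hξd Q hQ0 hQbil hQrad hQdrift hmis
    hneg hsep U Φ hΦ hU hdev hOfut (max τ₀ τ₁)
  -- notation
  set rp : Fin N → U → ℝ := fun j x ↦ Kerr.radius (a j) (poincareInv (Λ j (x.1 0))
    (E4.ofTimeSpace (x.1 0) (ξ j (x.1 0))) x.1) with hrp
  set W : Set 𝒟.carrier := Φ '' {x : U | τ₀ < x.1 0 ∧ ∀ j, Kerr.rPlus (M j) (a j) < rp j x} with hW
  have hrpc : ∀ j, Continuous (rp j) := fun j ↦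
    (continuous_paintedRadius (a j) (Λ j) (ξ j) (hΛc j) (hξc j)).comp continuous_subtype_val
  have hWo : IsOpen W := isOpen_image_late_of_continuous hembΦ rp hrpc fun j ↦ Kerr.rPlus (M j) (a j)
  set S : Set 𝒟.carrier := range 𝒟.embed with hS
  have hSC := 𝒟.isCauchyHypersurface
  have h2 : (2 : ℕ∞ω) ≤ ((⊤ : ℕ∞) : ℕ∞ω) := WithTop.coe_le_coe.mpr le_top
  have hWJ : W ⊆ 𝒟.metric.causalFuture 𝒟.timeOrientation S := by
    intro z hz
    have := himO hz
    rw [hO] at this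
    exact this.1
  -- facts along the curve
  have hlateσ : ∀ σ, τ₀ < xs σ 0 ∧ τ₁ < xs σ 0 := fun σ ↦
    ⟨(le_max_left _ _).trans_lt (hpts σ).1, (le_max_right _ _).trans_lt (hpts σ).1⟩
  have hWmem : ∀ σ, Kerr.rPlus (M i) (a i) < rp i ⟨xs σ, hxsU σ⟩ → Φ ⟨xs σ, hxsU σ⟩ ∈ W := by
    intro σ hσ
    refine ⟨⟨xs σ, hxsU σ⟩, ⟨(hlateσ σ).1, fun j ↦ ?_⟩, rfl⟩
    by_cases hj : j = i
    · subst hj; exact hσ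
    · exact (hpts σ).2.2 j hj
  have hend' : Kerr.rPlus (M i) (a i) < rp i ⟨xs 1, hxsU 1⟩ := hend
  have hstart' : rp i ⟨xs 0, hxsU 0⟩ < Kerr.rPlus (M i) (a i) := hstart
  -- the first parameter in `J⁺(S)`
  have hγc : ContinuousOn (fun σ ↦ Φ ⟨xs σ, hxsU σ⟩) (Icc 0 1) :=
    continuousOn_of_isFutureCausalCurveOn hcurve
  set A : Set ℝ := Icc 0 1 ∩ (fun σ ↦ Φ ⟨xs σ, hxsU σ⟩) ⁻¹' 𝒟.metric.causalFuture 𝒟.timeOrientation S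
    with hA
  have hAc : IsClosed A :=
    hγc.preimage_isClosed_of_isClosed isClosed_Icc (hSC.isClosed_causalFuture_set h2)
  have h1A : (1 : ℝ) ∈ A := ⟨⟨zero_le_one, le_rfl⟩, hWJ (hWmem 1 hend')⟩
  have hbdd : BddBelow A := ⟨0, fun s hs ↦ hs.1.1⟩
  set s₀ : ℝ := sInf A with hs₀
  have hs₀A : s₀ ∈ A := hAc.csInf_mem ⟨1, h1A⟩ hbdd
  have hs₀I : s₀ ∈ Icc (0 : ℝ) 1 := hs₀A.1
  have hbefore : ∀ s ∈ Icc (0 : ℝ) 1, s < s₀ →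
      Φ ⟨xs s, hxsU s⟩ ∉ 𝒟.metric.causalFuture 𝒟.timeOrientation S := fun s hs hlt hJ ↦
    (not_le.mpr hlt) (csInf_le hbdd ⟨hs, hJ⟩)
  rcases lt_or_ge (Kerr.rPlus (M i) (a i)) (rp i ⟨xs s₀, hxsU s₀⟩) with hext | hint
  · -- exterior at `s₀`: earlier points are exterior too, against minimality
    have hs₀pos : 0 < s₀ := by
      rcases eq_or_lt_of_le hs₀I.1 with h | h
      · exfalso
        have h' : xs s₀ = xs 0 := by rw [← h]
        have : rp i ⟨xs s₀, hxsU s₀⟩ = rp i ⟨xs 0, hxsU 0⟩ := by simp only [hrp, h']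
        linarith
      · exact h
    have hWs : Φ ⟨xs s₀, hxsU s₀⟩ ∈ W := hWmem s₀ hext
    have hnhds : (fun σ ↦ Φ ⟨xs σ, hxsU σ⟩) ⁻¹' W ∈ 𝓝[Icc 0 1] s₀ :=
      (hγc.continuousWithinAt hs₀I) (hWo.mem_nhds hWs)
    obtain ⟨η, hη, hηP⟩ := Metric.mem_nhdsWithin_iff.mp hnhds
    set s : ℝ := max 0 (s₀ - η / 2) with hs
    have hsI : s ∈ Icc (0 : ℝ) 1 := ⟨le_max_left _ _, by
      rw [hs]; exact max_le zero_le_one (by linarith [hs₀I.2])⟩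
    have hslt : s < s₀ := by rw [hs]; exact max_lt hs₀pos (by linarith)
    have hsdist : s ∈ ball s₀ η := by
      rw [mem_ball, Real.dist_eq, abs_lt]
      have : s₀ - η / 2 ≤ s := le_max_right _ _
      constructor <;> linarith
    have hsW : Φ ⟨xs s, hxsU s⟩ ∈ W := hηP ⟨hsdist, hsI⟩
    exact hbefore s hsI hslt (hWJ hsW)
  · -- interior-or-horizon at `s₀`: the point is in `O`, against the horizon lemma F1
    have hJW : Φ ⟨xs s₀, hxsU s₀⟩ ∈ 𝒟.metric.causalPast 𝒟.timeOrientation W :=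
      mem_causalPast_of_curve (hcurve.mono (Icc_subset_Icc hs₀I.1 le_rfl)) ⟨hs₀I.2, le_rfl⟩
        (hWmem 1 hend')
    have hIW := mem_chronologicalPast_of_mem_causalPast_of_isOpen 𝒟 hWo hJW
    have hO' : Φ ⟨xs s₀, hxsU s₀⟩ ∈ O := by rw [hO]; exact ⟨hs₀A.2, hIW⟩
    have hinj : InjOn Φ {x : U | τ₀ < x.1 0} := by
      intro x hx y hy hxy
      have h := hembΦ.injective (a₁ := ⟨x, hx⟩) (a₂ := ⟨y, hy⟩) hxy
      exact congrArg Subtype.val h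
    have hF1 := SublinearIsFree.Rechart.painted_exterior_of_mem_exterior_guaranteed 𝒟 M a
      rin Λ ξ τ₀ τ₁ U Φ O
      hrin hinj hexh hT ⟨xs s₀, hxsU s₀⟩ (hlateσ s₀).1 (hlateσ s₀).2 (hpts s₀).2.1 hO' i
    have hF1' : Kerr.rPlus (M i) (a i) < rp i ⟨xs s₀, hxsU s₀⟩ := hF1
    linarith

end Exclusion

end Summit.FinalStateConjecture.FinalStateConjecture.Theorems
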